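import Mathlib.Analysis.Calculus.Deriv.Pow
import Mathlib.Analysis.Calculus.Deriv.Mul
import Mathlib.Analysis.Calculus.Deriv.Add
import Mathlib.Analysis.SpecialFunctions.Pow.Real
import HarnessLib

/-!
# The explicit Gegenbauer sums `C_n^{(a)}(s)`: derivatives and the ultraspherical equation

For a real parameter `a` and `n ∈ ℕ`, the Gegenbauer (ultraspherical) polynomial is the explicit
finite sum (Andrews–Askey–Roy (6.4.11) solved for the monomials, DLMF 18.5.10)

  `C_n^{(a)}(s) = ∑_{l ≤ n/2} (-1)^l (a)_{n-l} / (l! (n-2l)!) · (2s)^{n-2l}`,  `(a)_m = ∏_{i<m} (a+i)`.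

This file treats these sums as real functions of `s` (no polynomial ring), with the explicit
term-wise first and second derivative sums, and proves

* `hasDerivAt_gegenbauerSum`, `hasDerivAt_gegenbauerSumD` — `C' = D`, `D' = DD`;
* `gegenbauerSumD_succ` — the ladder `d/ds C_{n+1}^{(a)} = 2a · C_n^{(a+1)}` (AAR §6.4);
* `gegenbauerSum_ode` — **the ultraspherical differential equation** (AAR §6.4)
  `(1 - s²) C'' - (2a+1) s C' + n(n+2a) C = 0` at every real `s`, by comparing the coefficients
  of `(2s)^{n-2l-2}`: `4 (n-2l)(n-2l-1) c_l + 2(l+1)(2n-2l-2+2a) c_{l+1} = 0` for the coefficients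
  `c_l = (-1)^l (a)_{n-l}/(l!(n-2l)!)`.

The sums `gegen` (`a = 3/2`) and `gegenSix` (`a = 5/2`) of
`Literature.Geometry.Riemannian.SphericalCylinderEntropy` / `SphericalZonalKernelSeries` are the
special cases `gegenbauerSum (3/2)` and `gegenbauerSum (5/2)` (same expression).  The bivariate
homogeneous form `gegenbauerHom` of `GegenbauerBivariate.lean` (three-term recurrence, generating
function) is not connected here.  Everything is proved; no named facts.

## References
* G. E. Andrews, R. Askey, R. Roy, *Special Functions*, CUP 1999, §6.4: the explicit sum (6.4.11),
  the derivative formula and the differential equation of the ultraspherical polynomials.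
* NIST DLMF 18.5.10, 18.8.
-/

noncomputable section

open scoped BigOperators Nat
open Finset

namespace Literature.Analysis.SpecialFunctions

/-! ### The sums and their term-wise derivatives -/

/-- The coefficient `c_l = (-1)^l (a)_{n-l} / (l! (n-2l)!)` of `(2s)^{n-2l}` in `C_n^{(a)}(s)`. [folklore] -/
def gegenbauerCoeff (a : ℝ) (n l : ℕ) : ℝ :=
  (-1 : ℝ) ^ l * (∏ i ∈ Finset.range (n - l), (a + (i : ℝ))) /
    (((l.factorial : ℕ) : ℝ) * (((n - 2 * l).factorial : ℕ) : ℝ))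

/-- The Gegenbauer polynomial `C_n^{(a)}(s) = ∑_{l ≤ n/2} c_l (2s)^{n-2l}` as an explicit finite sum
(AAR (6.4.11), DLMF 18.5.10). [cite: AndrewsAskeyRoy1999, (6.4.11)] -/
def gegenbauerSum (a : ℝ) (n : ℕ) (s : ℝ) : ℝ :=
  ∑ l ∈ Finset.range (n / 2 + 1), gegenbauerCoeff a n l * (2 * s) ^ (n - 2 * l)

/-- The term-wise derivative `∑_l c_l (n-2l) (2s)^{n-2l-1} · 2` of `C_n^{(a)}`. [folklore] -/
def gegenbauerSumD (a : ℝ) (n : ℕ) (s : ℝ) : ℝ :=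
  ∑ l ∈ Finset.range (n / 2 + 1),
    gegenbauerCoeff a n l * (((n - 2 * l : ℕ) : ℝ) * (2 * s) ^ (n - 2 * l - 1) * 2)

/-- The term-wise second derivative `∑_l c_l (n-2l)(n-2l-1) (2s)^{n-2l-2} · 4` of `C_n^{(a)}`.
[folklore] -/
def gegenbauerSumDD (a : ℝ) (n : ℕ) (s : ℝ) : ℝ :=
  ∑ l ∈ Finset.range (n / 2 + 1),
    gegenbauerCoeff a n l * (((n - 2 * l : ℕ) : ℝ) *
      (((n - 2 * l - 1 : ℕ) : ℝ) * (2 * s) ^ (n - 2 * l - 1 - 1) * 2) * 2)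

/-- `C_0^{(a)} = 1`. [folklore] -/
@[simp] theorem gegenbauerSum_zero (a s : ℝ) : gegenbauerSum a 0 s = 1 := by
  simp [gegenbauerSum, gegenbauerCoeff]

/-- `C_1^{(a)}(s) = 2 a s`. [folklore] -/
theorem gegenbauerSum_one (a s : ℝ) : gegenbauerSum a 1 s = 2 * a * s := by
  rw [gegenbauerSum, show 1 / 2 + 1 = 1 from rfl, Finset.sum_range_one, gegenbauerCoeff,
    show 1 - 0 = 1 from rfl, Finset.prod_range_one, pow_zero,
    Nat.factorial_zero, Nat.factorial_one, Nat.cast_one, Nat.cast_zero, pow_one]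
  ring

/-- `d/ds C_n^{(a)} = D_n^{(a)}`. [folklore] -/
theorem hasDerivAt_gegenbauerSum (a : ℝ) (n : ℕ) (s : ℝ) :
    HasDerivAt (gegenbauerSum a n) (gegenbauerSumD a n s) s := by
  have h2s : HasDerivAt (fun x : ℝ => 2 * x) 2 s := by
    simpa using (hasDerivAt_id s).const_mul (2 : ℝ)
  unfold gegenbauerSum gegenbauerSumD
  refine HasDerivAt.fun_sum fun l _ => ?_
  exact (h2s.fun_pow (n - 2 * l)).const_mul _

/-- `d/ds D_n^{(a)} = DD_n^{(a)}`. [folklore] -/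
theorem hasDerivAt_gegenbauerSumD (a : ℝ) (n : ℕ) (s : ℝ) :
    HasDerivAt (gegenbauerSumD a n) (gegenbauerSumDD a n s) s := by
  have h2s : HasDerivAt (fun x : ℝ => 2 * x) 2 s := by
    simpa using (hasDerivAt_id s).const_mul (2 : ℝ)
  unfold gegenbauerSumD gegenbauerSumDD
  refine HasDerivAt.fun_sum fun l _ => ?_
  have h := ((h2s.fun_pow (n - 2 * l - 1)).const_mul (((n - 2 * l : ℕ) : ℝ))).mul_const (2 : ℝ)
  exact (h.const_mul (gegenbauerCoeff a n l)).congr_deriv (by ring)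

/-- `C_n^{(a)}` is continuous. [folklore] -/
theorem continuous_gegenbauerSum (a : ℝ) (n : ℕ) : Continuous (gegenbauerSum a n) := by
  unfold gegenbauerSum; fun_prop

/-- `D_n^{(a)}` is continuous. [folklore] -/
theorem continuous_gegenbauerSumD (a : ℝ) (n : ℕ) : Continuous (gegenbauerSumD a n) := by
  unfold gegenbauerSumD; fun_prop

/-- `DD_n^{(a)}` is continuous. [folklore] -/
theorem continuous_gegenbauerSumDD (a : ℝ) (n : ℕ) : Continuous (gegenbauerSumDD a n) := by
  unfold gegenbauerSumDD; fun_prop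

/-! ### The ladder `d/ds C_{n+1}^{(a)} = 2a C_n^{(a+1)}` -/

/-- The summand identity behind the ladder: for `2l ≤ n`,
`c_l^{(a)}(n+1) (n+1-2l) (2s)^{n-2l} 2 = 2a c_l^{(a+1)}(n) (2s)^{n-2l}` (`(a)_{m+1} = a (a+1)_m`).
[folklore] -/
theorem gegenbauerCoeff_succ_mul (a : ℝ) (n l : ℕ) (hl : 2 * l ≤ n) (s : ℝ) :
    gegenbauerCoeff a (n + 1) l *
        (((n + 1 - 2 * l : ℕ) : ℝ) * (2 * s) ^ (n + 1 - 2 * l - 1) * 2) =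
      2 * a * (gegenbauerCoeff (a + 1) n l * (2 * s) ^ (n - 2 * l)) := by
  unfold gegenbauerCoeff
  have e1 : n + 1 - l = (n - l) + 1 := by omega
  have e2 : n + 1 - 2 * l = (n - 2 * l) + 1 := by omega
  have e3 : n + 1 - 2 * l - 1 = n - 2 * l := by omega
  rw [e3, e2, e1, Finset.prod_range_succ', Nat.factorial_succ]
  have hP : ∏ i ∈ Finset.range (n - l), (a + ((i + 1 : ℕ) : ℝ)) =
      ∏ i ∈ Finset.range (n - l), (a + 1 + (i : ℝ)) :=
    Finset.prod_congr rfl fun i _ => by push_cast; ring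
  rw [hP]
  have hl0 : ((l.factorial : ℕ) : ℝ) ≠ 0 := by positivity
  have hn0 : (((n - 2 * l).factorial : ℕ) : ℝ) ≠ 0 := by positivity
  have hs0 : ((n - 2 * l : ℕ) : ℝ) + 1 ≠ 0 := by positivity
  push_cast
  field_simp
  ring

/-- **The ladder** `d/ds C_{n+1}^{(a)}(s) = 2a C_n^{(a+1)}(s)`, as the identity
`D_{n+1}^{(a)} = 2a C_n^{(a+1)}` of explicit sums.
[cite: AndrewsAskeyRoy1999, §6.4 (derivative of ultraspherical polynomials)] -/
theorem gegenbauerSumD_succ (a : ℝ) (n : ℕ) (s : ℝ) :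
    gegenbauerSumD a (n + 1) s = 2 * a * gegenbauerSum (a + 1) n s := by
  unfold gegenbauerSumD gegenbauerSum
  -- drop the vanishing top term when `n` is odd
  have hdrop : ∑ l ∈ Finset.range ((n + 1) / 2 + 1), gegenbauerCoeff a (n + 1) l *
        (((n + 1 - 2 * l : ℕ) : ℝ) * (2 * s) ^ (n + 1 - 2 * l - 1) * 2) =
      ∑ l ∈ Finset.range (n / 2 + 1), gegenbauerCoeff a (n + 1) l *
        (((n + 1 - 2 * l : ℕ) : ℝ) * (2 * s) ^ (n + 1 - 2 * l - 1) * 2) := by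
    rcases Nat.even_or_odd n with ⟨m, hm⟩ | ⟨m, hm⟩
    · have h : (n + 1) / 2 = n / 2 := by omega
      rw [h]
    · have h1 : (n + 1) / 2 + 1 = (n / 2 + 1) + 1 := by omega
      have h0 : n + 1 - 2 * (n / 2 + 1) = 0 := by omega
      rw [h1, Finset.sum_range_succ, h0]
      simp
  rw [hdrop, Finset.mul_sum]
  refine Finset.sum_congr rfl fun l hl => ?_
  have hl2 : 2 * l ≤ n := by
    have := Finset.mem_range.1 hl
    omega
  exact gegenbauerCoeff_succ_mul a n l hl2 s

/-- Hence `d/ds C_{n+1}^{(a)}(s) = 2a C_n^{(a+1)}(s)`.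
[cite: AndrewsAskeyRoy1999, §6.4 (derivative of ultraspherical polynomials)] -/
theorem hasDerivAt_gegenbauerSum_succ (a : ℝ) (n : ℕ) (s : ℝ) :
    HasDerivAt (gegenbauerSum a (n + 1)) (2 * a * gegenbauerSum (a + 1) n s) s := by
  rw [← gegenbauerSumD_succ]
  exact hasDerivAt_gegenbauerSum a (n + 1) s

/-! ### The ultraspherical differential equation -/

/-- `m (2s)^{m-1} s = m (2s)^m / 2` for every `m ∈ ℕ` (both sides vanish for `m = 0`). [folklore] -/
theorem gegenbauer_aux_pow_one (m : ℕ) (s : ℝ) :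
    (m : ℝ) * (2 * s) ^ (m - 1) * s = (m : ℝ) * (2 * s) ^ m / 2 := by
  cases m with
  | zero => simp
  | succ m => rw [Nat.add_sub_cancel, pow_succ]; ring

/-- `m (m-1) (2s)^{m-2} s² = m (m-1) (2s)^m / 4` for every `m ∈ ℕ` (ℕ-subtraction inside the casts;
both sides vanish for `m ≤ 1`). [folklore] -/
theorem gegenbauer_aux_pow_two (m : ℕ) (s : ℝ) :
    (m : ℝ) * ((m - 1 : ℕ) : ℝ) * (2 * s) ^ (m - 1 - 1) * s ^ 2 =
      (m : ℝ) * ((m : ℝ) - 1) * (2 * s) ^ m / 4 := by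
  rcases m with _ | _ | m
  · simp
  · simp
  · rw [show m + 1 + 1 - 1 - 1 = m by omega, show m + 1 + 1 - 1 = m + 1 by omega, pow_succ, pow_succ]
    push_cast
    ring

/-- `m · (m - 1)ₙ = m (m - 1)` in `ℝ` for every `m ∈ ℕ`. [folklore] -/
theorem gegenbauer_aux_cast_pred (m : ℕ) : (m : ℝ) * ((m - 1 : ℕ) : ℝ) = (m : ℝ) * ((m : ℝ) - 1) := by
  cases m with
  | zero => simp
  | succ m => push_cast; ring

/-- The coefficient identity behind the differential equation: for `2l + 2 ≤ n`,
`4 (n-2l)(n-2l-1) c_l + 2 (l+1) (2n-2l-2+2a) c_{l+1} = 0`. [folklore] -/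
theorem gegenbauerCoeff_ode_rel (a : ℝ) (n l : ℕ) (hl : 2 * l + 2 ≤ n) :
    gegenbauerCoeff a n l * (((n - 2 * l : ℕ) : ℝ) * ((n - 2 * l - 1 : ℕ) : ℝ) * 4) +
      gegenbauerCoeff a n (l + 1) * (2 * ((l : ℝ) + 1) * (2 * n - 2 * l - 2 + 2 * a)) = 0 := by
  unfold gegenbauerCoeff
  have e1 : n - l = (n - (l + 1)) + 1 := by omega
  have e2 : n - 2 * l = (n - 2 * (l + 1)) + 1 + 1 := by omega
  have e3 : n - 2 * l - 1 = (n - 2 * (l + 1)) + 1 := by omega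
  rw [e3, e2, e1, Finset.prod_range_succ, Nat.factorial_succ, Nat.factorial_succ (n - 2 * (l + 1)),
    Nat.factorial_succ l]
  have hp : ((n - (l + 1) : ℕ) : ℝ) = (n : ℝ) - l - 1 := by
    rw [Nat.cast_sub (by omega)]; push_cast; ring
  have hl0 : ((l.factorial : ℕ) : ℝ) ≠ 0 := by positivity
  have hq0 : (((n - 2 * (l + 1)).factorial : ℕ) : ℝ) ≠ 0 := by positivity
  have hq1 : ((n - 2 * (l + 1) : ℕ) : ℝ) + 1 ≠ 0 := by positivity
  have hq2 : ((n - 2 * (l + 1) : ℕ) : ℝ) + 1 + 1 ≠ 0 := by positivity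
  have hl1 : (l : ℝ) + 1 ≠ 0 := by positivity
  push_cast
  rw [hp]
  field_simp
  ring

/-- The term-wise form of the differential operator: for `2l ≤ n`, with `m = n - 2l`,
`(1-s²) c_l (m(m-1)(2s)^{m-2} 4) - (2a+1) s c_l (m (2s)^{m-1} 2) + n(n+2a) c_l (2s)^m
  = c_l m(m-1) 4 (2s)^{m-2} + c_l 2l(2n-2l+2a) (2s)^m`. [folklore] -/
theorem gegenbauer_ode_term (a : ℝ) (n l : ℕ) (hl : 2 * l ≤ n) (s : ℝ) :
    (1 - s ^ 2) * (gegenbauerCoeff a n l * (((n - 2 * l : ℕ) : ℝ) *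
        (((n - 2 * l - 1 : ℕ) : ℝ) * (2 * s) ^ (n - 2 * l - 1 - 1) * 2) * 2)) -
      (2 * a + 1) * s * (gegenbauerCoeff a n l * (((n - 2 * l : ℕ) : ℝ) * (2 * s) ^ (n - 2 * l - 1) * 2)) +
      (n : ℝ) * ((n : ℝ) + 2 * a) * (gegenbauerCoeff a n l * (2 * s) ^ (n - 2 * l)) =
    gegenbauerCoeff a n l * (((n - 2 * l : ℕ) : ℝ) * ((n - 2 * l - 1 : ℕ) : ℝ) * 4) *
        (2 * s) ^ (n - 2 * l - 1 - 1) +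
      gegenbauerCoeff a n l * (2 * (l : ℝ) * (2 * n - 2 * l + 2 * a)) * (2 * s) ^ (n - 2 * l) := by
  have h1 := gegenbauer_aux_pow_one (n - 2 * l) s
  have h2 := gegenbauer_aux_pow_two (n - 2 * l) s
  have h3 := gegenbauer_aux_cast_pred (n - 2 * l)
  have hM : ((n - 2 * l : ℕ) : ℝ) = (n : ℝ) - 2 * l := by
    rw [Nat.cast_sub hl]; push_cast; ring
  -- isolate the two power facts
  have key : (1 - s ^ 2) * (((n - 2 * l : ℕ) : ℝ) *
        (((n - 2 * l - 1 : ℕ) : ℝ) * (2 * s) ^ (n - 2 * l - 1 - 1) * 2) * 2) -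
      (2 * a + 1) * s * (((n - 2 * l : ℕ) : ℝ) * (2 * s) ^ (n - 2 * l - 1) * 2) +
      (n : ℝ) * ((n : ℝ) + 2 * a) * (2 * s) ^ (n - 2 * l) =
    ((n - 2 * l : ℕ) : ℝ) * ((n - 2 * l - 1 : ℕ) : ℝ) * 4 * (2 * s) ^ (n - 2 * l - 1 - 1) +
      2 * (l : ℝ) * (2 * n - 2 * l + 2 * a) * (2 * s) ^ (n - 2 * l) := by
    have eA : (1 - s ^ 2) * (((n - 2 * l : ℕ) : ℝ) *
        (((n - 2 * l - 1 : ℕ) : ℝ) * (2 * s) ^ (n - 2 * l - 1 - 1) * 2) * 2) =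
        ((n - 2 * l : ℕ) : ℝ) * ((n - 2 * l - 1 : ℕ) : ℝ) * 4 * (2 * s) ^ (n - 2 * l - 1 - 1) -
          4 * (((n - 2 * l : ℕ) : ℝ) * ((n - 2 * l - 1 : ℕ) : ℝ) * (2 * s) ^ (n - 2 * l - 1 - 1) *
            s ^ 2) := by ring
    have eB : (2 * a + 1) * s * (((n - 2 * l : ℕ) : ℝ) * (2 * s) ^ (n - 2 * l - 1) * 2) =
        2 * (2 * a + 1) * (((n - 2 * l : ℕ) : ℝ) * (2 * s) ^ (n - 2 * l - 1) * s) := by ring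
    rw [eA, eB, h1, h2, h3, hM]
    ring
  linear_combination gegenbauerCoeff a n l * key

/-- **The ultraspherical differential equation** for the explicit sums:
`(1 - s²) C'' - (2a+1) s C' + n(n+2a) C = 0` at every real `s`, with `C'`, `C''` the term-wise
derivative sums `gegenbauerSumD`, `gegenbauerSumDD`.
[cite: AndrewsAskeyRoy1999, §6.4 (ultraspherical differential equation)] -/
theorem gegenbauerSum_ode (a : ℝ) (n : ℕ) (s : ℝ) :
    (1 - s ^ 2) * gegenbauerSumDD a n s - (2 * a + 1) * s * gegenbauerSumD a n s +
      (n : ℝ) * ((n : ℝ) + 2 * a) * gegenbauerSum a n s = 0 := by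
  unfold gegenbauerSumDD gegenbauerSumD gegenbauerSum
  rw [Finset.mul_sum, Finset.mul_sum, Finset.mul_sum, ← Finset.sum_sub_distrib,
    ← Finset.sum_add_distrib]
  rw [Finset.sum_congr rfl fun l hl => gegenbauer_ode_term a n l
    (by have := Finset.mem_range.1 hl; omega) s, Finset.sum_add_distrib]
  -- the top term of the first sum vanishes
  rw [Finset.sum_range_succ]
  have htop : gegenbauerCoeff a n (n / 2) * (((n - 2 * (n / 2) : ℕ) : ℝ) *
      ((n - 2 * (n / 2) - 1 : ℕ) : ℝ) * 4) * (2 * s) ^ (n - 2 * (n / 2) - 1 - 1) = 0 := by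
    rcases (show n - 2 * (n / 2) = 0 ∨ n - 2 * (n / 2) - 1 = 0 by omega) with h | h
    · rw [h]; simp
    · rw [h]; simp
  rw [htop, add_zero]
  -- the bottom term of the second sum vanishes; shift its index
  rw [Finset.sum_range_succ' (fun l => gegenbauerCoeff a n l * (2 * (l : ℝ) * (2 * n - 2 * l + 2 * a)) *
    (2 * s) ^ (n - 2 * l))]
  simp only [Nat.cast_zero, mul_zero, zero_mul, add_zero]
  rw [← Finset.sum_add_distrib]
  refine Finset.sum_eq_zero fun l hl => ?_
  have hl2 : 2 * l + 2 ≤ n := by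
    have := Finset.mem_range.1 hl
    omega
  have e : n - 2 * (l + 1) = n - 2 * l - 1 - 1 := by omega
  rw [e]
  have h := gegenbauerCoeff_ode_rel a n l hl2
  push_cast at h ⊢
  linear_combination (2 * s) ^ (n - 2 * l - 1 - 1) * h

end Literature.Analysis.SpecialFunctions
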